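import Literature.AlgebraicGeometry.Frobenioids.ArchimedeanIsometrization
import Literature.AlgebraicGeometry.Frobenioids.ArchimedeanIsotropy
import HarnessLib

/-!
# Frobenioids II, Theorem 3.6 (iii): the isometrization functor `C → A`, the isotropification
# functors `C → C^istr`, `A → A^istr`, and the printed claim "`C ⥲ A ×_{A^istr} C^istr`" at the
# categories of Example 3.3 (definitions + the closed instance; the proof is a separate file)

Mochizuki, *The geometry of Frobenioids II*, Kyushu J. Math. **62** (2008) 401–460, §3, Theorem 3.6
(iii), author's kurims text p. 37 [cite: MochizukiFrdII2008, Thm 3.6 (iii) p.37]: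

> "(iii) Every morphism `φ : B → A` of `C` factors uniquely as a composite `φ = β ∘ α`, where `α` is an
> isometry [hence belongs to `A`], and `β ∈ O^▷(A)` […]. Moreover, the assignment `φ ↦ α` determines an
> 'isometrization functor' `C → A` which, together with the isotropification functors `C → C^istr`,
> `A → A^istr` [cf. [Mzk5], Proposition 1.9, (v)], determines an equivalence of categories
> `C ⥲ A ×_{A^istr} C^istr` that is 1-compatible with the natural functors to `F_Φ` on both sides."

The generic predicate `ArchFrd.Thm36iii_equivalence` (`ArchimedeanBasicProperties.lean`) takes the four
functors and the 1-commutativity isomorphism as parameters; `ArchimedeanTheoremsInstances.lean` left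
this clause uninstantiated ("the isometrization / isotropification functors … are not yet in the tree").
This file CONSTRUCTS them for `C π = C₀ ×_{D₀} D` over any base `π : D → D₀` and states the closed
instance `Thm36iii_equivalence_C π` (a `Prop`; nothing is asserted here — it is PROVED in
`ArchimedeanIsometrizationEquivalence.lean`):

* `isomFunctor : C → A`, `φ ↦ α =` the isometric part of `φ` (`ArchimedeanIsometrization.lean`, the
  factorization of (iii); functoriality PROVED here: the isometric part of a composite is the composite
  of the isometric parts);
* `istrFunctor : C → C^istr`, `(Spec K, V, A_K; D) ↦` the same object with the ISOTROPIC angular region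
  of the same tip (abc-iut-L1-t6's `C0.isotropify`; isotropic in `C` by t6's Ex. 3.3 (ii)
  `Ex33ii_isotropic_iff_holds`), an arrow `↦` the arrow with the same data `(Base, deg_Fr, c)` — this is
  the isotropic hull `A → A^istr` of [FrdI] Def. 1.2 (iv) made functorial, as in [FrdI] Prop. 1.9 (v);
* `A.istrFunctor : A → A^istr` likewise, and `isomIFunctor : C^istr → A^istr` (restriction of `isomFunctor`);
* the square `isom ⋙ A.istr = istrC ⋙ isomI` commutes ON THE NOSE (`eIso`).

No statement of the paper is strengthened; typed ≠ proved (proof: the companion file).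
-/

namespace Literature.AlgebraicGeometry.Frobenioids

open CategoryTheory
open scoped Pointwise

noncomputable section

universe v u

namespace ArchFrd

namespace C0

variable {X Y Z : C0}

/-! ### `C₀`: the arrow induced on isotropifications; functoriality of the isometric part -/

/-- The arrow `X^{iso} → Y^{iso}` induced by `φ : X → Y`: the same data `(Base, deg_Fr, c)` (the angular
condition holds because `|c| · tip(X)^d ≤ tip(Y)` and the regions are isotropic).
[cite: MochizukiFrdII2008, Thm 3.6 (iii) p.37] -/
def isotropifyMap (φ : X ⟶ Y) : isotropify X ⟶ isotropify Y where
  base := (Hom.base φ : X.base ⟶ Y.base)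
  degFr := Hom.degFr φ
  scalar := Hom.scalar φ
  scalar_mem := Hom.scalar_mem φ
  mapsTo := by
    rintro _ ⟨v, hv, rfl⟩
    have hv' : ‖(v : ℂ)‖ ≤ X.tip ^ (degFr φ : ℕ) := norm_le_of_mem_carrier_pow (isotropify X).region _ _ hv
    change scalar φ * v ∈ D0.galAct _ '' (isotropify Y).region.carrier
    rw [image_galAct_of_isIsotropic (isNaivelyIsotropic_isotropify Y),
      mem_carrier_of_isIsotropic (isNaivelyIsotropic_isotropify Y), ← Subtype.coe_le_coe, coe_absHom,
      Units.val_mul, norm_mul]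
    calc ‖(scalar φ : ℂ)‖ * ‖(v : ℂ)‖ ≤ ‖(scalar φ : ℂ)‖ * X.tip ^ (degFr φ : ℕ) := by gcongr
      _ ≤ Y.tip := norm_scalar_mul_tip_pow_le φ

/-- `isotropifyMap` of an identity. [cite: MochizukiFrdII2008, Thm 3.6 (iii) p.37] -/
theorem isotropifyMap_id (X : C0) : isotropifyMap (𝟙 X) = 𝟙 (isotropify X) := hom_ext rfl rfl rfl

/-- `isotropifyMap` of a composite. [cite: MochizukiFrdII2008, Thm 3.6 (iii) p.37] -/
theorem isotropifyMap_comp (ψ : X ⟶ Y) (φ : Y ⟶ Z) :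
    isotropifyMap (ψ ≫ φ) = isotropifyMap ψ ≫ isotropifyMap φ := hom_ext rfl rfl rfl

/-- The ratio (hence `Div`) of `isotropifyMap φ` is that of `φ`. [cite: MochizukiFrdII2008, Ex 3.3 (i) p.28] -/
theorem ratio_isotropifyMap (φ : X ⟶ Y) : ratio (isotropifyMap φ) = ratio φ := rfl

/-- Isotropification commutes with taking isometric parts (same data on both sides).
[cite: MochizukiFrdII2008, Thm 3.6 (iii) p.37] -/
theorem isotropifyMap_isometricPart (φ : X ⟶ Y) :
    isotropifyMap (isometricPart φ) = isometricPart (isotropifyMap φ) := hom_ext rfl rfl rfl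

/-- Naturality of `X → X^{iso}` (abc-iut-L1-t6's `toIsotropic`). [cite: MochizukiFrdII2008, Ex 3.3 (ii) p.28] -/
theorem toIsotropic_naturality (φ : X ⟶ Y) : φ ≫ toIsotropic Y = toIsotropic X ≫ isotropifyMap φ := by
  refine hom_ext ?_ ?_ ?_
  · change Base φ ≫ 𝟙 _ = 𝟙 _ ≫ Base φ
    rw [Category.comp_id, Category.id_comp]
  · change degFr φ * 1 = 1 * degFr φ
    rw [mul_one, one_mul]
  · rw [scalar_comp', scalar_comp']
    change (Base φ).act 1 * scalar φ ^ ((1 : ℕ+) : ℕ) = D0.Hom.act (𝟙 X.base) (scalar φ) * 1 ^ (degFr φ : ℕ)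
    rw [map_one, one_mul, PNat.one_coe, pow_one, one_pow, mul_one]
    change scalar φ = D0.galAct (D0.Hom.twists (𝟙 X.base)) (scalar φ)
    rw [D0.twists_id, D0.galAct_false]

/-- The positive real `ratio` of an identity is `1`. [cite: MochizukiFrdII2008, Ex 3.3 (i) p.28] -/
theorem ratioPos_id (X : C0) : ratioPos (𝟙 X) = 1 := Subtype.ext (ratio_id X)

/-- The positive real `ratio` of a composite. [cite: MochizukiFrdII2008, Ex 3.3 (i) p.28] -/
theorem ratioPos_comp (ψ : X ⟶ Y) (φ : Y ⟶ Z) :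
    ratioPos (ψ ≫ φ) = ratioPos φ * ratioPos ψ ^ (degFr φ : ℕ) :=
  Subtype.ext (by rw [Positive.val_mul, Positive.val_pow]; exact ratio_comp ψ φ)

/-- The isometric part of an identity is the identity. [cite: MochizukiFrdII2008, Thm 3.6 (iii) p.37] -/
theorem isometricPart_id (X : C0) : isometricPart (𝟙 X) = 𝟙 X := by
  refine hom_ext rfl rfl ?_
  change scalar (𝟙 X) * ofPosReal ℂ (ratioPos (𝟙 X)) = scalar (𝟙 X)
  rw [ratioPos_id, map_one, mul_one]

/-- **Functoriality of the isometrization** (Thm. 3.6 (iii), "determines an 'isometrization functor'"):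
the isometric part of a composite is the composite of the isometric parts (the radial factors are
positive reals, fixed by the Galois twists). [cite: MochizukiFrdII2008, Thm 3.6 (iii) p.37] -/
theorem isometricPart_comp (ψ : X ⟶ Y) (φ : Y ⟶ Z) :
    isometricPart (ψ ≫ φ) = isometricPart ψ ≫ isometricPart φ := by
  refine hom_ext rfl rfl ?_
  rw [scalar_comp']
  change scalar (ψ ≫ φ) * ofPosReal ℂ (ratioPos (ψ ≫ φ)) =
    (Base ψ).act (scalar φ * ofPosReal ℂ (ratioPos φ)) * (scalar ψ * ofPosReal ℂ (ratioPos ψ)) ^ (degFr φ : ℕ)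
  rw [scalar_comp', ratioPos_comp, map_mul, map_mul, map_pow, mul_pow]
  change _ = D0.galAct _ (scalar φ) * D0.galAct _ (ofPosReal ℂ (ratioPos φ)) * _
  rw [D0.galAct_eq_self_of_mem_scalars_real _ (ofPosReal_mem_scalars _ .real)]
  simp only [mul_assoc, mul_comm, mul_left_comm]

/-- The isometric part of an isometry is the isometry itself. [cite: MochizukiFrdII2008, Thm 3.6 (iii) p.37] -/
theorem isometricPart_of_isIsometry (φ : X ⟶ Y) (h : PreFrobenioid.IsIsometry C0.toElem φ) :
    isometricPart φ = φ := by
  refine hom_ext rfl rfl ?_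
  have hr : ratioPos φ = 1 := Subtype.ext ((A0.isIsometry_iff_ratio_eq_one φ).1 h)
  change scalar φ * ofPosReal ℂ (ratioPos φ) = scalar φ
  rw [hr, map_one, mul_one]

end C0

variable {D : Type u} [Category.{v} D] (π : D ⥤ D0)

/-! ### The isotropification functor `C → C^istr` -/

/-- `X^{istr}`: the object of `C` with the same base data and the isotropic angular region of the same tip
(an isotropic hull of `X`, [FrdI] Def. 1.2 (iv)). [cite: MochizukiFrdII2008, Thm 3.6 (iii) p.37] -/
def istrObj (X : C π) : C π := ⟨C0.isotropify X.fst, X.snd, X.iso⟩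

/-- `X^{istr}` is isotropic in `C` (Ex. 3.3 (ii): isotropic ⟺ naively isotropic, abc-iut-L1-t6).
[cite: MochizukiFrdII2008, Ex 3.3 (ii) p.28] -/
theorem istrObj_isIsotropic (X : C π) : PreFrobenioid.IsIsotropic (C.toElem π) (istrObj π X) :=
  (Ex33ii_isotropic_iff_holds π (istrObj π X)).2 (C0.isNaivelyIsotropic_isotropify X.fst)

/-- The arrow `X^{istr} → Y^{istr}` induced by `φ : X → Y` (same data). [cite: MochizukiFrdII2008, Thm 3.6 (iii) p.37] -/
def istrMap {X Y : C π} (φ : X ⟶ Y) : istrObj π X ⟶ istrObj π Y where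
  fst := C0.isotropifyMap φ.fst
  snd := φ.snd
  w := φ.w

/-- The isotropification as an endofunctor of `C`. [cite: MochizukiFrdII2008, Thm 3.6 (iii) p.37] -/
def istrEndo : C π ⥤ C π where
  obj := istrObj π
  map := istrMap π
  map_id X := CFP.hom_ext (C0.isotropifyMap_id X.fst) rfl
  map_comp φ ψ := CFP.hom_ext (C0.isotropifyMap_comp φ.fst ψ.fst) rfl

/-- **The isotropification functor `C → C^istr`** ([FrdI] Prop. 1.9 (v), for `C` of Ex. 3.3).
[cite: MochizukiFrdII2008, Thm 3.6 (iii) p.37] -/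
def istrFunctor : C π ⥤ (PreFrobenioid.isotropicObjects (C.toElem π)).FullSubcategory :=
  (PreFrobenioid.isotropicObjects (C.toElem π)).lift (istrEndo π) (istrObj_isIsotropic π)

/-- The hull arrow `X → X^{istr}` over the identity of `D` (t6's `toIsotropic` on the first component).
[cite: MochizukiFrdII2008, Ex 3.3 (ii) p.28] -/
def toIstr (X : C π) : X ⟶ istrObj π X where
  fst := C0.toIsotropic X.fst
  snd := 𝟙 X.snd
  w := by
    change 𝟙 _ ≫ X.iso.hom = X.iso.hom ≫ π.map (𝟙 X.snd)
    rw [CategoryTheory.Functor.map_id, Category.id_comp, Category.comp_id]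

/-- Naturality of `X → X^{istr}`. [cite: MochizukiFrdII2008, Ex 3.3 (ii) p.28] -/
theorem toIstr_naturality {X Y : C π} (φ : X ⟶ Y) : φ ≫ toIstr π Y = toIstr π X ≫ istrMap π φ :=
  CFP.hom_ext (C0.toIsotropic_naturality φ.fst) (by
    change φ.snd ≫ 𝟙 _ = 𝟙 _ ≫ φ.snd
    rw [Category.comp_id, Category.id_comp])

/-! ### The isometrization functor `C → A` -/

/-- The isometric part at the level of `C` is an isometry of `C`. [cite: MochizukiFrdII2008, Thm 3.6 (iii) p.37] -/
theorem isIsometry_isometricPart {X Y : C π} (φ : X ⟶ Y) :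
    PreFrobenioid.IsIsometry (C.toElem π) (isometricPart π φ) :=
  C0.isIsometry_isometricPart φ.fst

/-- The isometric part of an identity of `C`. [cite: MochizukiFrdII2008, Thm 3.6 (iii) p.37] -/
theorem isometricPart_id (X : C π) : isometricPart π (𝟙 X) = 𝟙 X :=
  CFP.hom_ext (C0.isometricPart_id X.fst) rfl

/-- The isometric part of a composite of `C`. [cite: MochizukiFrdII2008, Thm 3.6 (iii) p.37] -/
theorem isometricPart_comp {X Y Z : C π} (ψ : X ⟶ Y) (φ : Y ⟶ Z) :
    isometricPart π (ψ ≫ φ) = isometricPart π ψ ≫ isometricPart π φ :=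
  CFP.hom_ext (C0.isometricPart_comp ψ.fst φ.fst) rfl

/-- **The isometrization functor `C → A`**, `φ ↦ α` (Thm. 3.6 (iii)). [cite: MochizukiFrdII2008, Thm 3.6 (iii) p.37] -/
def isomFunctor : C π ⥤ A π where
  obj X := ⟨X⟩
  map φ := ⟨isometricPart π φ, isIsometry_isometricPart π φ⟩
  map_id X := WideSubcategory.hom_ext _ (isometricPart_id π X)
  map_comp ψ φ := WideSubcategory.hom_ext _ (isometricPart_comp π ψ φ)

/-! ### The isotropification functor `A → A^istr` and the restriction `C^istr → A^istr` -/

namespace A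

/-- `istrMap` of an isometry is an isometry. [cite: MochizukiFrdII2008, Ex 3.3 (iii) p.29] -/
theorem isIsometry_istrMap {X Y : A π} (f : X ⟶ Y) :
    PreFrobenioid.IsIsometry (C.toElem π) (istrMap π f.1) := by
  have h : PreFrobenioid.IsIsometry C0.toElem f.1.fst := f.2
  have h' : PreFrobenioid.IsIsometry C0.toElem (C0.isotropifyMap f.1.fst) := by
    rw [A0.isIsometry_iff_ratio_eq_one] at h ⊢; exact h
  exact h'

/-- The isotropification as an endofunctor of `A`. [cite: MochizukiFrdII2008, Thm 3.6 (iii) p.37] -/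
def istrEndo : A π ⥤ A π where
  obj X := ⟨istrObj π X.obj⟩
  map f := ⟨istrMap π f.1, isIsometry_istrMap π f⟩
  map_id X := WideSubcategory.hom_ext _ ((ArchFrd.istrEndo π).map_id X.obj)
  map_comp f g := WideSubcategory.hom_ext _ ((ArchFrd.istrEndo π).map_comp f.1 g.1)

/-- `⟨X^{istr}⟩` is isotropic in `A` ("the isotropic objects of `A` are precisely the isotropic objects of
`C`", Ex. 3.3 (iii), abc-iut-L1-t6's `Ex33iii_isotropic_iff_holds`). [cite: MochizukiFrdII2008, Ex 3.3 (iii) p.29] -/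
theorem istrObj_isIsotropic (X : A π) :
    PreFrobenioid.IsIsotropic (A.toElem π) ((istrEndo π).obj X) :=
  (Ex33iii_isotropic_iff_holds π _).2 (ArchFrd.istrObj_isIsotropic π X.obj)

/-- **The isotropification functor `A → A^istr`**. [cite: MochizukiFrdII2008, Thm 3.6 (iii) p.37] -/
def istrFunctor : A π ⥤ (PreFrobenioid.isotropicObjects (A.toElem π)).FullSubcategory :=
  (PreFrobenioid.isotropicObjects (A.toElem π)).lift (istrEndo π) (istrObj_isIsotropic π)

end A

/-- An isotropic object of `C` is isotropic in `A`. [cite: MochizukiFrdII2008, Ex 3.3 (iii) p.29] -/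
theorem isIsotropic_A_of_C (X : (PreFrobenioid.isotropicObjects (C.toElem π)).FullSubcategory) :
    PreFrobenioid.IsIsotropic (A.toElem π) ((isomFunctor π).obj X.obj) :=
  (Ex33iii_isotropic_iff_holds π _).2 X.property

/-- **The restriction `C^istr → A^istr` of the isometrization functor.**
[cite: MochizukiFrdII2008, Thm 3.6 (iii) p.37] -/
def isomIFunctor :
    (PreFrobenioid.isotropicObjects (C.toElem π)).FullSubcategory ⥤
      (PreFrobenioid.isotropicObjects (A.toElem π)).FullSubcategory :=
  (PreFrobenioid.isotropicObjects (A.toElem π)).lift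
    ((PreFrobenioid.isotropicObjects (C.toElem π)).ι ⋙ isomFunctor π) (isIsotropic_A_of_C π)

/-- The square `C → A → A^istr`, `C → C^istr → A^istr` commutes on the nose (isotropification does not
change the data `(Base, deg_Fr, c)`, and the ratio of an arrow depends only on `c` and the tips).
[cite: MochizukiFrdII2008, Thm 3.6 (iii) p.37] -/
theorem isom_istr_eq : isomFunctor π ⋙ A.istrFunctor π = istrFunctor π ⋙ isomIFunctor π := rfl

/-- The 1-commutativity isomorphism of the square (here the identity: the two composites coincide
definitionally). [cite: MochizukiFrdII2008, Thm 3.6 (iii) p.37] -/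
def eIso : isomFunctor π ⋙ A.istrFunctor π ≅ istrFunctor π ⋙ isomIFunctor π := Iso.refl _

/-- The components of `eIso` are identities. [cite: MochizukiFrdII2008, Thm 3.6 (iii) p.37] -/
theorem eIso_hom_app (X : C π) : (eIso π).hom.app X = 𝟙 _ := rfl

/-- **Thm. 3.6 (iii), the equivalence `C ⥲ A ×_{A^istr} C^istr`** at the categories of Example 3.3 over a
base `π : D → D₀` (the printed claim as a `Prop`; PROVED in `ArchimedeanIsometrizationEquivalence.lean`):
the functor `C → A ×_{A^istr} C^istr` determined by (isometrization, isotropification, the commuting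
square) is an equivalence, 1-compatibly with the functors to `F_Φ` (through `C^istr → F_Φ`).
[cite: MochizukiFrdII2008, Thm 3.6 (iii) p.37] -/
def Thm36iii_equivalence_C : Prop :=
  Thm36iii_equivalence (C.toElem π) (isomFunctor π) (A.istrFunctor π) (istrFunctor π) (isomIFunctor π)
    (eIso π) (istr (C.toElem π))

end ArchFrd

end

end Literature.AlgebraicGeometry.Frobenioids
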